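import Summits.ABC.ABC.Theses.YuMatveevShapeRat
import Summits.ABC.StewartYu.PadicG3TwoSatSupplyW
import Summits.ABC.ABC.Theorems.YuMatveevShapeRatPadicCoreTwoRatCount
import Summits.ABC.ABC.Theorems.YuMatveevShapeRatPadicCoreTwoRatLines
import Literature.NumberTheory.Transcendental.Nesterenko2003Prop51Holds
import HarnessLib

set_option linter.dupNamespace false

/-!
# LINE `padic-two-sat-frame` (v5 FINAL, padded letter; SORRY-FREE — both stubs discharged by name, crux CLOSED 2026-08-27T22:16:13Z by ✓ p578169) — crux `PadicCoreTwoRat` (stmt-ABC-20504), route `YuMatveevShapeRat`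
# (A1.L), lead p3-g10

The 𝔑-threaded (Kummer-free) `2`-adic Gen-3 frame is LANDED up to the record's COUNT and LINES (cell abc-stewartyu, HOME
`run/shared/lean/pub/abc-stewartyu/`; design STATUS 2026-08-27T18:43Z/19:02Z and the padded-letter correction ≈20:50Z, memo-13):
`TwoSetup.frameTwoRat_of_recordSatDet : SatKitFullDet (d+1) → RecordSupplyTwoSatDet C d → FrameTwoRat C (d+1)` (`PadicG3TwoFrameSatDet`),
`TwoSetup.recordSupplyTwoSatDet_of_suppliesW : (∀ d ≥ 1, 2^{111(d+1)}(1 + c_W d) ≤ C(d+1)) → CountSupplyTwoNW → LinesSupplyTwoNW →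
EndSupplyTwoNW C → ∀ d ≥ 1, RecordSupplyTwoSatDet C d` (`PadicG3TwoSatSupplyW`; the record is p3-g6's `ParTwo.parTwo V Vmax (W + c_W d)`,
`c_W d = (2d+5)(d+1)`; the smallness pack is lp-1's ✓ `smallPackTwoN_of_gain`; the END is ✓ `endSupplyTwoNW_of` through
✓ `ParTwo.recordTwo_parTwo_W`).  The two open stubs (texts = `Summits/ABC/StewartYu/PadicG3TwoSatSupplyW.lean`):

* `stub_countTwoN` — `CountSupplyTwoNW`: the Siegel count over `𝔑` (L1N) of `schedTwoN` at the padded record — S;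
* `stub_linesTwoN` — `LinesSupplyTwoNW`: the GAIN branches of (L2₀)/(L2)/(L3) of `schedTwoN` at the padded record from the size data
  (sizes ✓ `PadicG3TwoSizesN/SizesThirdN`, atoms ✓ `PadicG3TwoArithN/ArithBN`; budgets to come) — L;

and `PadicCoreTwoRat_of` composes them BY NAME with ✓ `endSupplyTwoNW_of`, ✓ `recordSupplyTwoSatDet_of_suppliesW`, ✓ `satKitFullDet_holds`,
✓ `frameTwoRat_of_recordSatDet`, ✓ `GenThreeBaseTwoRat.padicCoreTwoRat_of_frame_two_le` and the ✓ zero estimate `Nesterenko2003_prop51_holds`.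
The constant of record is `CLine m = (2^113)^m` (`2^{111(d+1)}·(1 + c_W d) ≤ 2^{113(d+1)}` as `1 + c_W d ≤ 4^{d+1}`; `≥ 256` for the END).
-/

open Finset

namespace Summit.ABC.ABC.Cruxes.PadicCoreTwoRat.PadicTwoSatFrame

open Summit.ABC.StewartYu Summit.ABC.StewartYu.GenThreeFrameSpecTwoRat
open Literature.NumberTheory.Transcendental Literature.NumberTheory.Transcendental.GaGm

/-- The constant of the line. [folklore] -/
noncomputable def cLine : ℝ := (2 : ℝ) ^ 113

/-- The constant FUNCTION of record `C m = cLine ^ m`. [folklore] -/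
noncomputable def CLine (m : ℕ) : ℝ := cLine ^ m

/-- `0 ≤ CLine r ≤ cLine ^ r`. [folklore] -/
theorem CLine_bounds : ∀ r, 0 ≤ CLine r ∧ CLine r ≤ cLine ^ r := fun r => ⟨by unfold CLine cLine; positivity, le_rfl⟩

/-- `4 ≤ CLine 1`. [folklore] -/
theorem four_le_CLine_one : 4 ≤ CLine 1 := by
  unfold CLine cLine; norm_num

/-- `256^{n−r}·CLine r ≤ CLine n` for `r < n` (`cLine ≥ 256`). [folklore] -/
theorem CLine_growth : ∀ n r, r < n → (256 : ℝ) ^ (n - r) * CLine r ≤ CLine n := by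
  intro n r hr
  unfold CLine
  have hc : (256 : ℝ) ≤ cLine := by unfold cLine; norm_num
  calc (256 : ℝ) ^ (n - r) * cLine ^ r ≤ cLine ^ (n - r) * cLine ^ r :=
        mul_le_mul_of_nonneg_right (pow_le_pow_left₀ (by norm_num) hc _) (by unfold cLine; positivity)
    _ = cLine ^ n := by rw [← pow_add, Nat.sub_add_cancel hr.le]

/-- The padding fits the constant: `2^{111(d+1)}·(1 + c_W d) ≤ CLine (d+1)` for `d ≥ 1`. [folklore] -/
theorem CLine_pad : ∀ d : ℕ, 1 ≤ d → (2 : ℝ) ^ (111 * (d + 1)) * (1 + (TwoSetup.cW d : ℝ)) ≤ CLine (d + 1) := by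
  intro d hd
  have h := TwoSetup.one_add_cW_le_four_pow hd
  have h' : (1 : ℝ) + (TwoSetup.cW d : ℝ) ≤ (4 : ℝ) ^ (d + 1) := by exact_mod_cast h
  unfold CLine cLine
  rw [← pow_mul, show (4 : ℝ) = 2 ^ 2 by norm_num, ← pow_mul] at *
  calc (2 : ℝ) ^ (111 * (d + 1)) * (1 + (TwoSetup.cW d : ℝ)) ≤ (2 : ℝ) ^ (111 * (d + 1)) * (2 : ℝ) ^ (2 * (d + 1)) :=
        mul_le_mul_of_nonneg_left h' (by positivity)
    _ = (2 : ℝ) ^ (113 * (d + 1)) := by rw [← pow_add]; congr 1; ring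

namespace Sig

/-- Statement of `stub_countTwoN` — the Siegel count over `𝔑` at the padded record. [cite: Nesterenko2003, Prop 3.9 (3.48), §3.5; shape only] -/
def stub_countTwoN : Prop := Summit.ABC.StewartYu.TwoSetup.CountSupplyTwoNW

/-- Statement of `stub_linesTwoN` — the gain branches of the k-step / third-step lines at the padded record.
[cite: Nesterenko2003, §4 (4.20)–(4.35); shape only] [cite: Yu2013, Lemma 5.2, Lemma 5.4; shape only] -/
def stub_linesTwoN : Prop := Summit.ABC.StewartYu.TwoSetup.LinesSupplyTwoNW

end Sig

/-- STUB (COUNT) — DISCHARGED by name by ✓ `Summit.ABC.ABC.Theorems.stub_countTwoNW` (p573270, `…PadicCoreTwoRatCount`). -/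
theorem stub_countTwoN : Sig.stub_countTwoN := Summit.ABC.ABC.Theorems.stub_countTwoNW

/-- STUB (LINES) — DISCHARGED by name by ✓ `Summit.ABC.ABC.Theorems.stub_linesTwoNW` (p577795, `…PadicCoreTwoRatLines`). -/
theorem stub_linesTwoN : Sig.stub_linesTwoN := Summit.ABC.ABC.Theorems.stub_linesTwoNW

/-- **The END supply at the padded letter, DISCHARGED** by ✓ `TwoSetup.endSupplyTwoNW_of`. -/
theorem endTwoNW : TwoSetup.EndSupplyTwoNW CLine := TwoSetup.endSupplyTwoNW_of (fun r => (CLine_bounds r).1) CLine_growth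

/-- Composition: the crux BY NAME from the two stub statements (both now discharged; the landed closer is
✓ `Summit.ABC.ABC.Theorems.PadicCoreTwoRat_proof`, `…PadicCoreTwoRatLine`), through ✓ `endTwoNW`, ✓ `recordSupplyTwoSatDet_of_suppliesW`,
✓ `satKitFullDet_holds`, ✓ `TwoSetup.frameTwoRat_of_recordSatDet`, ✓ `GenThreeBaseTwoRat.padicCoreTwoRat_of_frame_two_le` and the ✓ zero
estimate `Nesterenko2003_prop51_holds`. [folklore] -/
theorem PadicCoreTwoRat_of :
    Sig.stub_countTwoN → Sig.stub_linesTwoN → Summit.ABC.ABC.Theses.YuMatveevShapeRat.PadicCoreTwoRat := by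
  intro hCo hLi
  have hR : ∀ d, 1 ≤ d → TwoSetup.RecordSupplyTwoSatDet CLine d :=
    fun d hd => TwoSetup.recordSupplyTwoSatDet_of_suppliesW CLine_pad hCo hLi endTwoNW hd
  have hF : Nesterenko2003_prop51 → ∀ n, 2 ≤ n → FrameTwoRat CLine n := by
    intro _ n hn
    obtain ⟨d, rfl⟩ : ∃ d, n = d + 1 := ⟨n - 1, by omega⟩
    exact TwoSetup.frameTwoRat_of_recordSatDet (satKitFullDet_holds (d + 1)) (hR d (by omega))
  exact GenThreeBaseTwoRat.padicCoreTwoRat_of_frame_two_le CLine_bounds four_le_CLine_one hF Nesterenko2003_prop51_holds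

end Summit.ABC.ABC.Cruxes.PadicCoreTwoRat.PadicTwoSatFrame

namespace Summit.ABC.ABC.Cruxes.PadicCoreTwoRat.PadicTwoSatFrame

/-- The crux along THIS line's composition, sorry-free (equal by proof-irrelevance to the landed ✓ `Summit.ABC.ABC.Theorems.PadicCoreTwoRat_proof`). -/
theorem PadicCoreTwoRat_line : Summit.ABC.ABC.Theses.YuMatveevShapeRat.PadicCoreTwoRat :=
  PadicCoreTwoRat_of stub_countTwoN stub_linesTwoN

end Summit.ABC.ABC.Cruxes.PadicCoreTwoRat.PadicTwoSatFrame
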